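import Summits.QuantumAdvantage.QuantumAdvantage.Theorems.LivenessSeparationLawM

set_option linter.dupNamespace false

/-!
# Liveness separation, part T — the gap design for ARBITRARY cut sets

Lens 4 (minimal counterexample), node `CoSupportDial`, memo S-PRIME §10 (the adjacent-pair branch).
Parts N and P built the gap design for cuts that are pairwise `≥ 2` apart, where every gap can carry the
`≤ 2` ones a residue pattern asks for.  Here the separation hypothesis is replaced by STRICT MONOTONICITY of
the cuts (`hmono`) together with the FIT condition (`hfit`): the filling `x j` placed right after cut `j`
fits into the gap before cut `j + 1`.  The whole closed form of the walk exponents (part N) and the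
prescribed-residue / prescribed-liveness theorems (part P) go through verbatim under these hypotheses
(`walkExp_gapDesign_fit`, `walk_residue_gapPattern_fit`, `livenessPattern_fit`).  For adjacent cuts
`g (j+1) = g j + 1` the fit condition for the pattern filling reads `R (j+1) ≢ R j` (`xPattern_fit_adjacent_iff`):
adjacent cuts can be designed to any pair of DISTINCT residues, never to equal ones — in particular never both dead.
-/

namespace Summit.QuantumAdvantage.QuantumAdvantage.Theorems.LivenessSeparation

open Finset Summit.QuantumAdvantage.AdviceFreeQNC0 InnerDegreeDial

variable {n : ℕ}

section FitDesign

variable {T : ℕ} {g : ℕ → ℕ} {x₀ : ℕ} {x : ℕ → ℕ}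

/-- strictly increasing cuts: `g j + (j' - j) ≤ g j'` -/
theorem add_le_of_mono (hmono : ∀ j, j + 1 < T → g j < g (j + 1)) {j j' : ℕ} (hjj : j ≤ j') (hj' : j' < T) :
    g j + (j' - j) ≤ g j' := by
  induction j' with
  | zero =>
    have : j = 0 := by omega
    subst this
    simp
  | succ k ih =>
    rcases Nat.lt_or_eq_of_le hjj with h | h
    · have h1 := ih (by omega) (by omega)
      have h2 := hmono k hj'
      omega
    · subst h
      simp

/-- strictly increasing cuts are monotone -/
theorem le_of_mono (hmono : ∀ j, j + 1 < T → g j < g (j + 1)) {j j' : ℕ} (hjj : j ≤ j') (hj' : j' < T) : g j ≤ g j' :=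
  le_trans (Nat.le_add_right _ _) (add_le_of_mono hmono hjj hj')

/-- a fitting filling ends before every later cut -/
theorem fit_le_of_lt (hmono : ∀ j, j + 1 < T → g j < g (j + 1)) (hfit : ∀ j, j + 1 < T → g j + x j ≤ g (j + 1)) {j l : ℕ}
    (hjl : j < l) (hl : l < T) : g j + x j ≤ g l :=
  le_trans (hfit j (by omega)) (le_of_mono hmono (show j + 1 ≤ l by omega) hl)

/-- inside the gap after cut `l` the design is the initial segment of length `x l` -/
theorem gapDesign_mem_gap_fit (hmono : ∀ j, j + 1 < T → g j < g (j + 1)) (hfit : ∀ j, j + 1 < T → g j + x j ≤ g (j + 1))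
    (hx₀ : x₀ ≤ g 0) {l : ℕ} (hl : l < T) (i : Fin n) (h1 : g l ≤ i.val) (h2 : l + 1 < T → i.val < g (l + 1)) :
    gapDesign n T g x₀ x i = true ↔ i.val < g l + x l := by
  unfold gapDesign
  rw [decide_eq_true_iff]
  constructor
  · rintro (h | ⟨j, hj, hj1, hj2⟩)
    · have := le_of_mono hmono (Nat.zero_le l) hl
      omega
    · rcases lt_trichotomy j l with hjl | hjl | hjl
      · have := fit_le_of_lt hmono hfit hjl hl
        omega
      · subst hjl
        exact hj2
      · have h3 := h2 (by omega)
        have := le_of_mono hmono (show l + 1 ≤ j by omega) hj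
        omega
  · intro h
    exact Or.inr ⟨l, hl, h1, h⟩

/-- before the first cut the design is the initial segment of length `x₀` -/
theorem gapDesign_mem_head_mono (hmono : ∀ j, j + 1 < T → g j < g (j + 1)) (i : Fin n) (h2 : i.val < g 0) :
    gapDesign n T g x₀ x i = true ↔ i.val < x₀ := by
  unfold gapDesign
  rw [decide_eq_true_iff]
  constructor
  · rintro (h | ⟨j, hj, hj1, hj2⟩)
    · exact h
    · have := le_of_mono hmono (Nat.zero_le j) hj
      omega
  · exact Or.inl

/-- ones of the design in the gap after cut `l` (up to the next cut, or to `n` after the last cut): `x l` -/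
theorem card_gapDesign_gap_fit (hmono : ∀ j, j + 1 < T → g j < g (j + 1)) (hfit : ∀ j, j + 1 < T → g j + x j ≤ g (j + 1))
    (hgn : g (T - 1) ≤ n) (hx₀ : x₀ ≤ g 0) (hxn : g (T - 1) + x (T - 1) ≤ n) {l : ℕ} (hl : l < T) (b : ℕ)
    (hb : b = if l + 1 < T then g (l + 1) else n) :
    (univ.filter fun i : Fin n => g l ≤ i.val ∧ i.val < b ∧ gapDesign n T g x₀ x i = true).card = x l := by
  have hlb : g l + x l ≤ b := by
    rw [hb]
    split_ifs with h
    · exact hfit l h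
    · have : l = T - 1 := by omega
      subst this
      exact hxn
  have hbn : b ≤ n := by
    rw [hb]
    split_ifs with h
    · exact le_trans (le_of_mono hmono (show l + 1 ≤ T - 1 by omega) (by omega)) hgn
    · exact le_rfl
  have e : (univ.filter fun i : Fin n => g l ≤ i.val ∧ i.val < b ∧ gapDesign n T g x₀ x i = true)
      = univ.filter fun i : Fin n => g l ≤ i.val ∧ i.val < g l + x l := by
    refine filter_congr fun i _ => ?_
    constructor
    · rintro ⟨h1, h2, h3⟩
      have h4 : l + 1 < T → i.val < g (l + 1) := fun h => by rw [hb, if_pos h] at h2; exact h2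
      exact ⟨h1, (gapDesign_mem_gap_fit hmono hfit hx₀ hl i h1 h4).mp h3⟩
    · rintro ⟨h1, h2⟩
      have h4 : l + 1 < T → i.val < g (l + 1) := fun h => by
        have := hfit l h
        omega
      exact ⟨h1, by omega, (gapDesign_mem_gap_fit hmono hfit hx₀ hl i h1 h4).mpr h2⟩
  rw [e, Summit.QuantumAdvantage.AdviceFreeQNC0.JLinPeel.SegMove.card_window (by omega)]
  omega

/-- ones of the design before the first cut: `x₀` -/
theorem card_gapDesign_head_mono (hmono : ∀ j, j + 1 < T → g j < g (j + 1)) (hT : 1 ≤ T) (hgn : g (T - 1) ≤ n) (hx₀ : x₀ ≤ g 0) :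
    (univ.filter fun i : Fin n => i.val < g 0 ∧ gapDesign n T g x₀ x i = true).card = x₀ := by
  have h0n : g 0 ≤ n := le_trans (le_of_mono hmono (Nat.zero_le _) (by omega)) hgn
  have e : (univ.filter fun i : Fin n => i.val < g 0 ∧ gapDesign n T g x₀ x i = true)
      = univ.filter fun i : Fin n => 0 ≤ i.val ∧ i.val < x₀ := by
    refine filter_congr fun i _ => ?_
    constructor
    · rintro ⟨h1, h2⟩
      exact ⟨Nat.zero_le _, (gapDesign_mem_head_mono hmono i h1).mp h2⟩
    · rintro ⟨-, h2⟩
      exact ⟨by omega, (gapDesign_mem_head_mono hmono i (by omega)).mpr h2⟩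
  rw [e, Summit.QuantumAdvantage.AdviceFreeQNC0.JLinPeel.SegMove.card_window (by omega)]
  omega

/-- prefix weight of the design at cut `l`: `x₀ + Σ_{j<l} x j` -/
theorem wtPrefix_gapDesign_fit (hmono : ∀ j, j + 1 < T → g j < g (j + 1)) (hfit : ∀ j, j + 1 < T → g j + x j ≤ g (j + 1))
    (hT : 1 ≤ T) (hgn : g (T - 1) ≤ n) (hx₀ : x₀ ≤ g 0) (hxn : g (T - 1) + x (T - 1) ≤ n) {l : ℕ} (hl : l < T) :
    wtPrefix (gapDesign n T g x₀ x) (g l) = x₀ + ∑ j ∈ range l, x j := by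
  induction l with
  | zero =>
    rw [sum_range_zero, add_zero]
    exact card_gapDesign_head_mono hmono hT hgn hx₀
  | succ k ih =>
    have hk : k < T := by omega
    have h1 := walkExp_eq_add_card (gapDesign n T g x₀ x) (le_of_mono hmono (show k ≤ k + 1 by omega) hl)
    unfold walkExp at h1
    rw [ih hk, card_gapDesign_gap_fit hmono hfit hgn hx₀ hxn hk (g (k + 1)) (by rw [if_pos hl])] at h1
    rw [sum_range_succ]
    omega

/-- weight of the design: `x₀ + Σ_{j<T} x j` -/
theorem wt_gapDesign_fit (hmono : ∀ j, j + 1 < T → g j < g (j + 1)) (hfit : ∀ j, j + 1 < T → g j + x j ≤ g (j + 1))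
    (hT : 1 ≤ T) (hgn : g (T - 1) ≤ n) (hx₀ : x₀ ≤ g 0) (hxn : g (T - 1) + x (T - 1) ≤ n) :
    wt (gapDesign n T g x₀ x) = x₀ + ∑ j ∈ range T, x j := by
  have h1 := walkExp_eq_add_card (gapDesign n T g x₀ x) hgn
  unfold walkExp at h1
  rw [Summit.QuantumAdvantage.AdviceFreeQNC0.ConstBells.wtPrefix_self, wtPrefix_gapDesign_fit hmono hfit hT hgn hx₀ hxn (show T - 1 < T by omega),
    card_gapDesign_gap_fit hmono hfit hgn hx₀ hxn (show T - 1 < T by omega) n (by rw [if_neg (by omega)])] at h1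
  obtain ⟨T', rfl⟩ : ∃ T', T = T' + 1 := ⟨T - 1, by omega⟩
  rw [sum_range_succ]
  simp only [Nat.add_sub_cancel] at h1 ⊢
  omega

/-- walk exponent of the design at cut `l`, closed form -/
theorem walkExp_gapDesign_fit (hmono : ∀ j, j + 1 < T → g j < g (j + 1)) (hfit : ∀ j, j + 1 < T → g j + x j ≤ g (j + 1))
    (hT : 1 ≤ T) (hgn : g (T - 1) ≤ n) (hx₀ : x₀ ≤ g 0) (hxn : g (T - 1) + x (T - 1) ≤ n) {l : ℕ} (hl : l < T) :
    walkExp (gapDesign n T g x₀ x) (g l) = (x₀ + ∑ j ∈ range T, x j) + (x₀ + ∑ j ∈ range l, x j) := by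
  unfold walkExp
  rw [wt_gapDesign_fit hmono hfit hT hgn hx₀ hxn, wtPrefix_gapDesign_fit hmono hfit hT hgn hx₀ hxn hl]

end FitDesign

/-! ### prescribed residues and liveness under the fit condition -/

section FitPattern

variable {T : ℕ} {g : ℕ → ℕ}

/-- the pattern filling between two cuts does not depend on the final filling `xl` -/
theorem xPattern_of_lt {R : ℕ → ℕ} (xl : ℕ) {j : ℕ} (hj : j + 1 < T) :
    xPattern T g R xl j = (R (j + 1) + (3 - R j) + (3 - (g (j + 1) - g j) % 3)) % 3 := by
  unfold xPattern
  rw [if_pos hj]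

/-- the designed residues: `g l + Σ_{j<l} x j ≡ g 0 + R l - R 0 (mod 3)` (monotone cuts suffice) -/
theorem residue_xPattern_mono (hmono : ∀ j, j + 1 < T → g j < g (j + 1)) {R : ℕ → ℕ} {xl : ℕ} (hR : ∀ j, R j ≤ 2) {l : ℕ}
    (hl : l < T) : (g l + ∑ j ∈ range l, xPattern T g R xl j) % 3 = (g 0 + R l + (3 - R 0)) % 3 := by
  induction l with
  | zero =>
    have := hR 0
    rw [sum_range_zero]
    omega
  | succ k ih =>
    have hk : k < T := by omega
    have h1 := ih hk
    have h2 := xPattern_of_lt (g := g) (R := R) xl hl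
    have h3 := hmono k hl
    have h4 := hR k
    have h5 := hR (k + 1)
    have h6 := hR 0
    rw [sum_range_succ, h2]
    omega

/-- THE WALK RESIDUES OF THE PATTERN DESIGN under the fit condition: with `(★)`, cut `l` has walk residue `≡ R l`. -/
theorem walk_residue_gapPattern_fit (hmono : ∀ j, j + 1 < T → g j < g (j + 1)) {R : ℕ → ℕ} {xl : ℕ}
    (hfit : ∀ j, j + 1 < T → g j + xPattern T g R xl j ≤ g (j + 1)) (hT : 1 ≤ T) (hgn : g (T - 1) ≤ n)
    {c x₀ : ℕ} (hR : ∀ j, R j ≤ 2) (hx₀ : x₀ ≤ g 0) (hxln : g (T - 1) + xl ≤ n)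
    (hstar : (c + 2 * x₀ + xl + 2 * g 0 + 2 * g (T - 1) + R (T - 1) + 2 * (3 - R 0)) % 3 = 0)
    {l : ℕ} (hl : l < T) :
    (c + g l + walkExp (gapDesign n T g x₀ (xPattern T g R xl)) (g l)) % 3 = R l % 3 := by
  obtain ⟨T', rfl⟩ : ∃ T', T = T' + 1 := ⟨T - 1, by omega⟩
  have hxn : g (T' + 1 - 1) + xPattern (T' + 1) g R xl (T' + 1 - 1) ≤ n := by
    rw [Nat.add_sub_cancel, xPattern_last rfl]
    simpa using hxln
  rw [walkExp_gapDesign_fit hmono hfit hT hgn hx₀ hxn hl, sum_range_succ, xPattern_last rfl]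
  have r1 := residue_xPattern_mono hmono (xl := xl) hR hl
  have r2 := residue_xPattern_mono hmono (xl := xl) hR (show T' < T' + 1 by omega)
  simp only [Nat.add_sub_cancel] at hstar
  have h4 := hR l
  have h5 := hR T'
  have h6 := hR 0
  omega

/-- liveness of the pattern design at cut `l` under the fit condition: live iff `R l ≠ 0` -/
theorem gapPattern_liveCut_fit (hmono : ∀ j, j + 1 < T → g j < g (j + 1)) {R : ℕ → ℕ} {xl : ℕ}
    (hfit : ∀ j, j + 1 < T → g j + xPattern T g R xl j ≤ g (j + 1)) (hT : 1 ≤ T) (hgn : g (T - 1) ≤ n)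
    {c x₀ : ℕ} (hR : ∀ j, R j ≤ 2) (hx₀ : x₀ ≤ g 0) (hxln : g (T - 1) + xl ≤ n)
    (hstar : (c + 2 * x₀ + xl + 2 * g 0 + 2 * g (T - 1) + R (T - 1) + 2 * (3 - R 0)) % 3 = 0)
    {l : ℕ} (hl : l < T) (gl : Fin (n + 1)) (hgl : gl.val = g l) :
    liveCut c (gapDesign n T g x₀ (xPattern T g R xl)) gl = decide (R l ≠ 0) := by
  have h := walk_residue_gapPattern_fit (n := n) hmono hfit hT hgn (c := c) (x₀ := x₀) hR hx₀ hxln hstar hl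
  have hRl := hR l
  unfold liveCut
  rw [hgl]
  by_cases h0 : R l = 0
  · rw [h0] at h
    rw [h0, decide_eq_false (fun h' : (0 : ℕ) ≠ 0 => h' rfl), decide_eq_false_iff_not]
    omega
  · rw [decide_eq_true h0, decide_eq_true_eq]
    omega

/-- **PRESCRIBED LIVENESS PATTERN FOR ARBITRARY CUT SETS.**  `T ≥ 1` strictly increasing cuts `g 0 < ⋯ < g (T-1) ≤ n`, a residue pattern `R`
(values `≤ 2`) whose fillings fit into the gaps, `x₀ ≤ g 0` ones before the first cut, `xl` fitting ones after the last cut, and `(★)`: some input makes cut `l` live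
exactly when `R l ≠ 0`. -/
theorem livenessPattern_fit (hmono : ∀ j, j + 1 < T → g j < g (j + 1)) {R : ℕ → ℕ} {xl : ℕ}
    (hfit : ∀ j, j + 1 < T → g j + xPattern T g R xl j ≤ g (j + 1)) (hT : 1 ≤ T) (hgn : g (T - 1) ≤ n)
    {c x₀ : ℕ} (hR : ∀ j, R j ≤ 2) (hx₀ : x₀ ≤ g 0) (hxln : g (T - 1) + xl ≤ n)
    (hstar : (c + 2 * x₀ + xl + 2 * g 0 + 2 * g (T - 1) + R (T - 1) + 2 * (3 - R 0)) % 3 = 0) :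
    ∃ u : Fin n → Bool, ∀ l < T, ∀ gl : Fin (n + 1), gl.val = g l → liveCut c u gl = decide (R l ≠ 0) :=
  ⟨gapDesign n T g x₀ (xPattern T g R xl), fun _ hl gl hgl => gapPattern_liveCut_fit hmono hfit hT hgn hR hx₀ hxln hstar hl gl hgl⟩

/-- the fit condition is automatic across a gap of length `≥ 2` -/
theorem xPattern_fit_of_two_le {R : ℕ → ℕ} {xl : ℕ} (hxl : xl ≤ 2) {j : ℕ} (h2 : g j + 2 ≤ g (j + 1)) :
    g j + xPattern T g R xl j ≤ g (j + 1) := by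
  have := xPattern_le (T := T) (g := g) (R := R) hxl j
  omega

/-- **adjacent cuts:** across a gap of length `1` the fit condition says exactly that the two prescribed residues differ -/
theorem xPattern_fit_adjacent_iff {R : ℕ → ℕ} (xl : ℕ) (hR : ∀ j, R j ≤ 2) {j : ℕ} (hj : j + 1 < T) (h1 : g (j + 1) = g j + 1) :
    g j + xPattern T g R xl j ≤ g (j + 1) ↔ R (j + 1) ≠ R j := by
  rw [xPattern_of_lt xl hj, h1]
  have h4 := hR j
  have h5 := hR (j + 1)
  omega

end FitPattern

end Summit.QuantumAdvantage.QuantumAdvantage.Theorems.LivenessSeparation
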